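import Literature.IUT.LogVolume.GenuineLogTheta
import Literature.IUT.LogVolume.TensorPacketSlotUnion
import HarnessLib

/-!
# `−|log(Θ)|` of a genuine Θ-volume input does NOT depend on the choice of the ideles

Kernel probe accompanying the RQ7 audit of `GenuineLogThetaPoint.lean` (abc-iut-S2, route D3 part e) by
abc-iut-w5-d156: the point-level claim form `Cor22.Cor312AtDatum P l := ∀ T : ThetaVolumeDatumAt P l, T.Cor312Of`
quantifies over ALL genuine data at `(P, l)`, and a datum's `ThetaVolumeInput` carries — besides the pilot data `X`
and the section `σ` of places, which [IUTchI] Def. 3.1 makes part of the initial Θ-data — the IDELES `t_Θ`, `t_q`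
(`GenuineLogTheta.lean`: "the only non-canonical choice … UNITS of the genuine completion `K_{v̲}` with
`ord_v(t_{Θ,j,v}) = j²·ord_v(q_v)/(2l)`"). In print the regions are the ARITHMETIC LINE BUNDLES `O_𝕃(−P_Θ)`,
`O_𝕃(−P_q)` (Dupuy–Hilado §3.9 "let `a ∈ 𝔸_{V̲}` be such that `D = div(a)`; `O_𝕃(−D) := a·O_𝕃`" — independent of
`a`; [IUTchI] Ex. 3.2 (iv) "`q̲_v :=` a `2l`-th root of `q_v`" — any two differ by a unit of absolute value `1`).
We PROVE that the tree's defined number agrees: two inputs with the same `(X, σ)` have the same `−|log(Θ)|`,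
the same `−|log(q)|`, hence equivalent `Cor312Of` / `Cor312NonarchOf` / `HullEstimateOf δ`. So the `∀ T` of
`Cor312AtDatum` ranges, as far as the NUMBERS are concerned, only over print's data (theta field, `K`, initial
Θ-data, section `V̲`) — the idele slot adds no junk and no strength.

* `realPrimePacketWith_pilotRegion_eq_of_norm_eq` — in the genuine packet `realPrimePacketWith p 𝔽 c`
  (c312-3; covers `realPrimePacket` and Mochizuki's `realPrimePacketM`), the region `O_𝕃(−div t)_p` depends only
  on the absolute values `‖t_{j,v}‖` (a slot unit of norm `1` does not move `(R_I)^∼`, abc-iut-S1's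
  `iota_smul_normalizedPacket_eq_of_norm_eq_one`); hence so do `possibleImages`, their hull and
  `negLogThetaAt` / `negAbsLogQAt` (`…_negLogThetaAt_eq_of_norm_eq`, `…_negAbsLogQAt_eq_of_norm_eq`);
* `LocalFields.norm_eq_of_ordv_eq` — equal `ord_v` ⇒ equal norm;
* `ThetaVolumeInput.negLogTheta_eq_of_X_eq_of_sigma_eq`, `negAbsLogQ_eq_of_X_eq`, `cor312Of_iff_of_X_eq_of_sigma_eq`,
  `cor312NonarchOf_iff_of_X_eq_of_sigma_eq`, `hullEstimateOf_iff_of_X_eq_of_sigma_eq`.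

Proof-only (no definitions, no named facts); classical bookkeeping over landed definitions; TAKES NO SIDE on
[IUTchIII] Cor. 3.12 (nothing here asserts `Cor312Of` for any input).
-/

noncomputable section

namespace Literature.IUT.LogVolume

open NumberField IsDedekindDomain Set
open scoped Pointwise

/-! ## Packet level: the pilot region depends only on the absolute values of the idele -/

section Packet

variable {F : Type} [Field F] [NumberField F] (p : ℕ) [Fact p.Prime] (𝔽 : LocalFields F p)
  (c : (j : ℕ) → (Fin (j + 1) → placesOver F p) → ℚ_[p]) (hc0 : ∀ j e, c j e ≠ 0)
  (hcσ : ∀ (j : ℕ) (σ : Equiv.Perm (Fin (j + 1))) (e : Fin (j + 1) → placesOver F p), c j (e ∘ σ) = c j e)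

/-- Equal `F`-normalised valuations `ord_v` force equal absolute values in `K_{v̲}`
(`ord_v(a) = −e_v·log‖a‖/log p`, `e_v ≠ 0`). [cite: DupuyHilado2025, §2.4.2] -/
theorem LocalFields.norm_eq_of_ordv_eq {v : placesOver F p} {a b : (𝔽.k v)ˣ} (h : 𝔽.ordv a = 𝔽.ordv b) :
    ‖(a : 𝔽.k v)‖ = ‖(b : 𝔽.k v)‖ := by
  have hp : (1 : ℝ) < p := by exact_mod_cast (Fact.out : p.Prime).one_lt
  have hlogp : Real.log p ≠ 0 := (Real.log_pos hp).ne'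
  have he : (ramIdx F v.1 : ℝ) ≠ 0 := by exact_mod_cast ramIdx_ne_zero F v.1
  have ha : 0 < ‖(a : 𝔽.k v)‖ := norm_pos_iff.mpr a.ne_zero
  have hb : 0 < ‖(b : 𝔽.k v)‖ := norm_pos_iff.mpr b.ne_zero
  unfold LocalFields.ordv at h
  have h' : Real.log ‖(a : 𝔽.k v)‖ = Real.log ‖(b : 𝔽.k v)‖ := by
    have h1 := congrArg (fun x : ℝ => x * Real.log p / (-(ramIdx F v.1 : ℝ))) h
    field_simp at h1
    linarith [h1]
  exact Real.log_injOn_pos ha hb h'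

/-- **The pilot region `O_𝕃(−div t)_p` of the genuine packet depends only on the absolute values of the idele**:
a slot unit of norm `1` does not move `(R_I)^∼`. [cite: DupuyHilado2025, §3.9] -/
theorem realPrimePacketWith_pilotRegion_eq_of_norm_eq {lstar : ℕ}
    (t t' : Fin lstar → (v : placesOver F p) → (𝔽.k v)ˣ)
    (h : ∀ (i : Fin lstar) (v : placesOver F p), ‖(t i v : 𝔽.k v)‖ = ‖(t' i v : 𝔽.k v)‖) :
    (realPrimePacketWith p 𝔽 c hc0 hcσ).pilotRegion t = (realPrimePacketWith p 𝔽 c hc0 hcσ).pilotRegion t' := by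
  funext j e
  unfold PrimePacket.pilotRegion
  split_ifs with hj
  · -- the translate `t_{j,v_j}·(R_I)^∼` only sees `‖t_{j,v_j}‖`
    set a : (𝔽.k (e (Fin.last j)))ˣ := t ⟨j - 1, hj.2⟩ (e (Fin.last j)) with ha
    set a' : (𝔽.k (e (Fin.last j)))ˣ := t' ⟨j - 1, hj.2⟩ (e (Fin.last j)) with ha'
    set k : Fin (j + 1) → Type := fun i => 𝔽.k (e i) with hk
    have hnorm : ‖(a : 𝔽.k (e (Fin.last j)))‖ = ‖(a' : 𝔽.k (e (Fin.last j)))‖ := h _ _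
    -- `a' = a·w` with `‖w‖ = 1`
    set w : (𝔽.k (e (Fin.last j)))ˣ := a⁻¹ * a' with hw
    have hw1 : ‖(w : 𝔽.k (e (Fin.last j)))‖ = 1 := by
      rw [hw, Units.val_mul, Units.val_inv_eq_inv_val, norm_mul, norm_inv, hnorm,
        inv_mul_cancel₀ (norm_ne_zero_iff.mpr a'.ne_zero)]
    have haw : (a' : 𝔽.k (e (Fin.last j))) = a * w := by
      rw [hw, Units.val_mul, Units.val_inv_eq_inv_val, ← mul_assoc,
        mul_inv_cancel₀ a.ne_zero, one_mul]
    show (fun x => iota p k (Fin.last j) (a : 𝔽.k (e (Fin.last j))) * x) ''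
        (normalizedPacket p k : Set (PacketAlgebra p k)) =
      (fun x => iota p k (Fin.last j) (a' : 𝔽.k (e (Fin.last j))) * x) ''
        (normalizedPacket p k : Set (PacketAlgebra p k))
    have hN : iota p k (Fin.last j) (w : 𝔽.k (e (Fin.last j))) •
        (normalizedPacket p k : Set (PacketAlgebra p k)) = normalizedPacket p k :=
      iota_smul_normalizedPacket_eq_of_norm_eq_one p k (Fin.last j) hw1
    calc (fun x => iota p k (Fin.last j) (a : 𝔽.k (e (Fin.last j))) * x) ''
          (normalizedPacket p k : Set (PacketAlgebra p k))
        = (fun x => iota p k (Fin.last j) (a : 𝔽.k (e (Fin.last j))) * x) ''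
            (iota p k (Fin.last j) (w : 𝔽.k (e (Fin.last j))) •
              (normalizedPacket p k : Set (PacketAlgebra p k))) := by rw [hN]
      _ = (fun x => iota p k (Fin.last j) (a' : 𝔽.k (e (Fin.last j))) * x) ''
            (normalizedPacket p k : Set (PacketAlgebra p k)) := by
          rw [← image_smul, image_image]
          refine image_congr' fun x => ?_
          rw [smul_eq_mul, ← mul_assoc, ← map_mul, haw]
  · rfl

/-- Hence `−|log(Θ)|` at the index `p` (hull of the possible images of the pilot region) depends only on the
absolute values of the idele. [cite: DupuyHilado2025, §1 (1.1), §4.11–4.12] -/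
theorem realPrimePacketWith_negLogThetaAt_eq_of_norm_eq {lstar : ℕ}
    (t t' : Fin lstar → (v : placesOver F p) → (𝔽.k v)ˣ)
    (h : ∀ (i : Fin lstar) (v : placesOver F p), ‖(t i v : 𝔽.k v)‖ = ‖(t' i v : 𝔽.k v)‖) :
    (realPrimePacketWith p 𝔽 c hc0 hcσ).negLogThetaAt lstar t =
      (realPrimePacketWith p 𝔽 c hc0 hcσ).negLogThetaAt lstar t' := by
  unfold PrimePacket.negLogThetaAt
  rw [realPrimePacketWith_pilotRegion_eq_of_norm_eq p 𝔽 c hc0 hcσ t t' h]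

/-- Likewise `−|log(q)|` at the index `p`. [cite: DupuyHilado2025, §3.9] -/
theorem realPrimePacketWith_negAbsLogQAt_eq_of_norm_eq {lstar : ℕ}
    (t t' : Fin lstar → (v : placesOver F p) → (𝔽.k v)ˣ)
    (h : ∀ (i : Fin lstar) (v : placesOver F p), ‖(t i v : 𝔽.k v)‖ = ‖(t' i v : 𝔽.k v)‖) :
    (realPrimePacketWith p 𝔽 c hc0 hcσ).negAbsLogQAt lstar t =
      (realPrimePacketWith p 𝔽 c hc0 hcσ).negAbsLogQAt lstar t' := by
  unfold PrimePacket.negAbsLogQAt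
  rw [realPrimePacketWith_pilotRegion_eq_of_norm_eq p 𝔽 c hc0 hcσ t t' h]

end Packet

/-! ## Input level: `−|log(Θ)|`, `−|log(q)|` and the claim forms depend only on `(X, σ)` -/

namespace ThetaVolumeInput

variable {F₀ : Type} [Field F₀] [NumberField F₀] {K : Type} [Field K] [NumberField K] [Algebra F₀ K]

/-- The support primes of an input depend only on `(X, K)`. [cite: Mochizuki2012, IUTchIV Thm. 1.10 Step (vi) p. 29] -/
theorem supportPrimes_mk_eq_mk (X : PilotData F₀) (σ : PlaceSection F₀ K) (tΘ tΘ' hΘ hΘ' tq tq' hq hq') :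
    (ThetaVolumeInput.mk X σ tΘ hΘ tq hq).supportPrimes =
      (ThetaVolumeInput.mk X σ tΘ' hΘ' tq' hq').supportPrimes := by
  unfold supportPrimes
  rfl

/-- The `p`-summand of `−|log(Θ)|` does not depend on the Θ-idele (only on its `ord_v`, which is prescribed).
[cite: DupuyHilado2025, §3.9, §4.11–4.12] -/
theorem negLogThetaLoc_mk_eq_mk (X : PilotData F₀) (σ : PlaceSection F₀ K) (tΘ tΘ' hΘ hΘ' tq tq' hq hq')
    (p : ℕ) :
    (ThetaVolumeInput.mk X σ tΘ hΘ tq hq).negLogThetaLoc p =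
      (ThetaVolumeInput.mk X σ tΘ' hΘ' tq' hq').negLogThetaLoc p := by
  by_cases hp : p.Prime
  · rw [negLogThetaLoc_of_prime _ hp, negLogThetaLoc_of_prime _ hp]
    haveI : Fact p.Prime := ⟨hp⟩
    unfold packetAt realPrimePacketM
    exact realPrimePacketWith_negLogThetaAt_eq_of_norm_eq p (σ.localFieldFamily p hp) _ _ _ _ _
      fun i v => LocalFields.norm_eq_of_ordv_eq p _ ((hΘ p hp i v).trans (hΘ' p hp i v).symm)
  · rw [negLogThetaLoc, negLogThetaLoc, dif_neg hp, dif_neg hp]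

/-- The nonarchimedean part of `−|log(Θ)|` does not depend on the ideles. [cite: DupuyHilado2025, §1 (1.1)] -/
theorem negLogThetaNonarch_mk_eq_mk (X : PilotData F₀) (σ : PlaceSection F₀ K) (tΘ tΘ' hΘ hΘ' tq tq' hq hq') :
    (ThetaVolumeInput.mk X σ tΘ hΘ tq hq).negLogThetaNonarch =
      (ThetaVolumeInput.mk X σ tΘ' hΘ' tq' hq').negLogThetaNonarch := by
  unfold negLogThetaNonarch
  rw [supportPrimes_mk_eq_mk X σ tΘ tΘ' hΘ hΘ' tq tq' hq hq']
  exact Finset.sum_congr rfl fun p _ => negLogThetaLoc_mk_eq_mk X σ tΘ tΘ' hΘ hΘ' tq tq' hq hq' p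

/-- The nonarchimedean part of `−|log(Θ)|` depends only on `(X, σ)`. [cite: DupuyHilado2025, §1 (1.1)] -/
theorem negLogThetaNonarch_eq_of_X_eq_of_sigma_eq (I I' : ThetaVolumeInput F₀ K) (hX : I.X = I'.X)
    (hσ : I.σ = I'.σ) : I.negLogThetaNonarch = I'.negLogThetaNonarch := by
  obtain ⟨X, σ, tΘ, hΘ, tq, hq⟩ := I
  obtain ⟨X', σ', tΘ', hΘ', tq', hq'⟩ := I'
  dsimp only at hX hσ
  subst hX
  subst hσ
  exact negLogThetaNonarch_mk_eq_mk X σ tΘ tΘ' hΘ hΘ' tq tq' hq hq'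

/-- **`−|log(Θ)|` of a genuine input does not depend on the Θ-idele**: two inputs with the same pilot data and the
same section of places have the same `−|log(Θ)|` (their ideles have the same `ord_v`, hence the same absolute
values, hence give the same pilot regions in the genuine packets). [cite: Mochizuki2012, IUTchIII Cor. 3.12 p. 173–174] -/
theorem negLogTheta_eq_of_X_eq_of_sigma_eq (I I' : ThetaVolumeInput F₀ K) (hX : I.X = I'.X) (hσ : I.σ = I'.σ) :
    I.negLogTheta = I'.negLogTheta := by
  have hl : I.l = I'.l := by unfold ThetaVolumeInput.l; rw [hX]
  unfold negLogTheta
  rw [negLogThetaNonarch_eq_of_X_eq_of_sigma_eq I I' hX hσ, hl]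

/-- `−|log(q)|` of a genuine input depends only on the pilot data. [cite: Mochizuki2012, IUTchIV Thm. 1.10 p. 23] -/
theorem negAbsLogQ_eq_of_X_eq (I I' : ThetaVolumeInput F₀ K) (hX : I.X = I'.X) : I.negAbsLogQ = I'.negAbsLogQ := by
  unfold negAbsLogQ
  rw [hX]

/-- Hence the claim form [IUTchIII] Cor. 3.12 for a genuine input depends only on `(X, σ)` (never asserted).
[claim: Mochizuki2012, status: disputed] -/
theorem cor312Of_iff_of_X_eq_of_sigma_eq (I I' : ThetaVolumeInput F₀ K) (hX : I.X = I'.X) (hσ : I.σ = I'.σ) :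
    I.Cor312Of ↔ I'.Cor312Of := by
  unfold Cor312Of
  rw [negLogTheta_eq_of_X_eq_of_sigma_eq I I' hX hσ, negAbsLogQ_eq_of_X_eq I I' hX]

/-- The nonarchimedean (Dupuy–Hilado (1.1)) claim form depends only on `(X, σ)` (never asserted).
[claim: Mochizuki2012, status: disputed] -/
theorem cor312NonarchOf_iff_of_X_eq_of_sigma_eq (I I' : ThetaVolumeInput F₀ K) (hX : I.X = I'.X)
    (hσ : I.σ = I'.σ) : I.Cor312NonarchOf ↔ I'.Cor312NonarchOf := by
  unfold Cor312NonarchOf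
  rw [negLogThetaNonarch_eq_of_X_eq_of_sigma_eq I I' hX hσ, negAbsLogQ_eq_of_X_eq I I' hX]

/-- The computable half `HullEstimateOf δ` depends only on `(X, σ)`.
[cite: Mochizuki2012, IUTchIV Thm. 1.10 Steps (v)–(viii) p. 27–31] -/
theorem hullEstimateOf_iff_of_X_eq_of_sigma_eq (I I' : ThetaVolumeInput F₀ K) (hX : I.X = I'.X)
    (hσ : I.σ = I'.σ) (δ : ℝ) : I.HullEstimateOf δ ↔ I'.HullEstimateOf δ := by
  unfold HullEstimateOf
  rw [negLogThetaNonarch_eq_of_X_eq_of_sigma_eq I I' hX hσ, hX]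

end ThetaVolumeInput

end Literature.IUT.LogVolume

end
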